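import Literature.Probability.RandomPlanarGeometry.SAWBrickWallHex
import HarnessLib

/-!
# Madras' sliding rule on the honeycomb lattice (brick-wall frame): at first touch with minimal gap `g`, every site of `P` within one row
# of a site of the translate `Q + (s,0)` lies at least `g` columns to its left (stub S2ℍ, first half, of LINE «HEX-MADRAS»)

Topic `Literature/Probability/RandomPlanarGeometry` (lane «pcv-sawmu», a-p4 g12; the honeycomb twin of TREE `SAWTriangularPolygonJoinSlide.lean`
(a-p4 g9, `TriPolygon.IsFirstContact`, `le_of_isFirstContact`); vocabulary of `SAWBrickWallHex.lean` (`Site 2`; the brick wall uses BOTH parities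
of `ℤ²`, and a translate of a brick-wall polygon is a brick-wall polygon iff the translation vector is even — so the horizontal slide at a fixed
vertical offset `τ` runs over the shifts `s ≡ τ (mod 2)`, in steps of `2`)).

Source: Madras' join as recalled by A. Hammond, arXiv:1504.05286v5 [Hammond2015SAPJoining], §3.4 p. 12 ("Translate `φ′` vertically so that some
vertices in `φ` and `φ′` share their `y`-coordinate, and then push `φ′` to the right … Then push `φ′` back to the left stopping just before the two
polygons overlap") and §4.1 pp. 17–18 ("shift `σ` to the left step by step until the first time at which there is a pair of vertices …" p. 17; "no vertex of
`τ` belongs to the right corridor" p. 18); N. Madras, J. Stat. Phys. 78 (1995) §2 is the primary, not held by the lane.  Honeycomb edition with a GAP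
PARAMETER `g` (the cap designer's choice: `g = 1` stops at contact, `g = 2` keeps a free column between the polygons): `Q` slides leftwards in
steps of `(2,0)`; TOUCH at shift `s` means some `t ∈ P` and `w ∈ Q` have `|t₁ − w₁| ≤ 1` and `w₀ + s − t₀ ∈ {g, g+1}`; FIRST touch = the largest
such `s` in its parity class.  The single fact behind the corridor remarks: **at first touch every site of `P` within one row of a site of
`Q + (s,0)` is at least `g` columns to its left** (`le_of_isFirstTouch`) — else the two sites would have touched at a larger shift of the same parity.
No parity hypothesis on `P`, `Q` is needed.

## What is proved (namespace `…SAW.HexBW`; all `theorem`s, axioms standard)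
* `IsNearShift g t w s`, `IsTouchShift g P Q s`, `IsFirstTouch g P Q s`, `touchShifts g P Q` (+ `mem_touchShifts_iff`);
* **`le_of_isFirstTouch`**: at first touch, `t ∈ P`, `w ∈ Q`, `|t₁ − w₁| ≤ 1 ⇒ t₀ + g ≤ w₀ + s`; `lt_of_isFirstTouch` (`1 ≤ g` ⇒ strict);
  `ne_add_of_isFirstTouch` (`1 ≤ g` ⇒ `P ∩ (Q + (s,0)) = ∅`); `touch_type_of_isFirstTouch` (a first-touch pair has gap `∈ {g, g+1}`);
* **`exists_isFirstTouch`**: for every parity `p`, a first touch with `s ≡ p (mod 2)` exists as soon as some rows of `P` and `Q` are within one.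
-/

noncomputable section

open Finset Literature.Probability.LatticeModels

namespace Literature.Probability.RandomPlanarGeometry.SAW

namespace HexBW

variable {P Q : Finset (Site 2)} {g s : ℤ}

/-- `t` is NEAR `w + (s,0)` with gap parameter `g`: within one row, and the translate is `g` or `g + 1` columns to the right of `t`
(`w₀ + s − t₀ ∈ {g, g+1}`, `|t₁ − w₁| ≤ 1`). [cite: Hammond2015SAPJoining, §4.1 (arXiv v5 p. 17: the first pair of nearby vertices); lane plumbing, honeycomb edition] -/
def IsNearShift (g : ℤ) (t w : Site 2) (s : ℤ) : Prop :=
  (t 1 = w 1 ∨ t 1 = w 1 + 1 ∨ t 1 + 1 = w 1) ∧ (t 0 + g = w 0 + s ∨ t 0 + g + 1 = w 0 + s)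

/-- `s` is a touch shift of `(P, Q)`: some site of `P` is near some site of `Q + (s,0)`. [cite: Hammond2015SAPJoining, §4.1 (arXiv v5 p. 17)] -/
def IsTouchShift (g : ℤ) (P Q : Finset (Site 2)) (s : ℤ) : Prop := ∃ t ∈ P, ∃ w ∈ Q, IsNearShift g t w s

/-- `s` is the FIRST touch shift of its parity class: a touch shift such that no larger shift of the same parity is one ("shift `σ` to the left
step by step until the first time …"). [cite: Hammond2015SAPJoining, §4.1 (arXiv v5 p. 17)] -/
def IsFirstTouch (g : ℤ) (P Q : Finset (Site 2)) (s : ℤ) : Prop :=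
  IsTouchShift g P Q s ∧ ∀ k : ℤ, 1 ≤ k → ¬IsTouchShift g P Q (s + 2 * k)

/-- **Madras' corridor fact, honeycomb edition.**  At first touch, a site of `P` within one row of a site of `Q + (s,0)` is at least `g` columns
to its left: `t₀ + g ≤ w₀ + s` — otherwise the two would have been near at a larger shift `s + 2k` of the same parity (`2k` = the even one of
`t₀ + g − w₀ − s`, `t₀ + g + 1 − w₀ − s`, which is `≥ 2`).
[cite: Hammond2015SAPJoining, §4.1 (arXiv v5 pp. 17–18: "no vertex of τ belongs to the right corridor … Equally, no vertex of σ′ belongs to the left corridor")] -/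
theorem le_of_isFirstTouch (h : IsFirstTouch g P Q s) {t w : Site 2} (ht : t ∈ P) (hw : w ∈ Q) (hy1 : w 1 ≤ t 1 + 1)
    (hy2 : t 1 ≤ w 1 + 1) : t 0 + g ≤ w 0 + s := by
  by_contra hcon
  push Not at hcon
  -- `d := t 0 + g - w 0 - s ≥ 1`; the next touch of this pair is at `2k ∈ {d, d + 1}`
  rcases Int.emod_two_eq_zero_or_one (t 0 + g - w 0 - s) with he | ho
  · refine h.2 ((t 0 + g - w 0 - s) / 2) (by omega) ⟨t, ht, w, hw, ?_⟩
    unfold IsNearShift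
    omega
  · refine h.2 ((t 0 + g - w 0 - s + 1) / 2) (by omega) ⟨t, ht, w, hw, ?_⟩
    unfold IsNearShift
    omega

/-- At first touch with `g ≥ 1`, `P` is strictly left of `Q + (s,0)` in every row and in every adjacent row.
[cite: Hammond2015SAPJoining, §4.1 (arXiv v5 p. 17)] -/
theorem lt_of_isFirstTouch (hg : 1 ≤ g) (h : IsFirstTouch g P Q s) {t w : Site 2} (ht : t ∈ P) (hw : w ∈ Q) (hy1 : w 1 ≤ t 1 + 1)
    (hy2 : t 1 ≤ w 1 + 1) : t 0 < w 0 + s := by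
  have := le_of_isFirstTouch h ht hw hy1 hy2
  omega

/-- At first touch with `g ≥ 1` the translate `Q + (s,0)` is disjoint from `P`.
[cite: Hammond2015SAPJoining, §3.4 (arXiv v5 p. 12: "stopping just before the two polygons overlap")] -/
theorem ne_add_of_isFirstTouch (hg : 1 ≤ g) (h : IsFirstTouch g P Q s) {t w : Site 2} (ht : t ∈ P) (hw : w ∈ Q) : t ≠ w + ![s, 0] := by
  intro he
  have h0 : t 0 = w 0 + s := by rw [he]; simp
  have h1 : t 1 = w 1 := by rw [he]; simp
  have := lt_of_isFirstTouch hg h ht hw (by omega) (by omega)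
  omega

/-- A first-touch pair is of type `w₀ + s − t₀ ∈ {g, g+1}` with `|t₁ − w₁| ≤ 1` (restated from the definition, for the cap table).
[cite: Hammond2015SAPJoining, §4.1 (arXiv v5 p. 17: the vertex Y)] -/
theorem touch_type_of_isFirstTouch (h : IsFirstTouch g P Q s) :
    ∃ t ∈ P, ∃ w ∈ Q, (t 1 = w 1 ∨ t 1 = w 1 + 1 ∨ t 1 + 1 = w 1) ∧ (w 0 + s = t 0 + g ∨ w 0 + s = t 0 + g + 1) := by
  obtain ⟨t, ht, w, hw, hc⟩ := h.1
  unfold IsNearShift at hc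
  exact ⟨t, ht, w, hw, hc.1, by omega⟩

/-! ### Existence of the first touch in a given parity class -/

open Classical in
/-- The finitely many candidate touch shifts (`t₀ + g − w₀`, `t₀ + g + 1 − w₀` over `t ∈ P`, `w ∈ Q`), filtered to the touch shifts.
[cite: Hammond2015SAPJoining, §4.1 (arXiv v5 p. 17: "such a moment necessarily occurs")] -/
def touchShifts (g : ℤ) (P Q : Finset (Site 2)) : Finset ℤ :=
  (((P ×ˢ Q).image fun tw => tw.1 0 + g - tw.2 0) ∪ ((P ×ˢ Q).image fun tw => tw.1 0 + g + 1 - tw.2 0)).filter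
    fun s => IsTouchShift g P Q s

/-- `touchShifts g P Q` is exactly the set of touch shifts. [cite: Hammond2015SAPJoining, §4.1 (arXiv v5 p. 17)] -/
theorem mem_touchShifts_iff : s ∈ touchShifts g P Q ↔ IsTouchShift g P Q s := by
  classical
  unfold touchShifts
  rw [Finset.mem_filter]
  refine ⟨fun h => h.2, fun h => ⟨?_, h⟩⟩
  obtain ⟨t, ht, w, hw, hc⟩ := h
  have htw : (t, w) ∈ P ×ˢ Q := Finset.mem_product.2 ⟨ht, hw⟩
  simp only [Finset.mem_union, Finset.mem_image]
  unfold IsNearShift at hc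
  rcases hc with ⟨-, hx | hx⟩
  · exact Or.inl ⟨(t, w), htw, by simp only; omega⟩
  · exact Or.inr ⟨(t, w), htw, by simp only; omega⟩

/-- **A first touch exists in every parity class** as soon as some site of `P` is within one row of some site of `Q` (take the largest touch
shift of parity `p`: of the two candidate shifts `t₀ + g − w₀`, `t₀ + g + 1 − w₀` of a nearby pair exactly one has parity `p`).
[cite: Hammond2015SAPJoining, §4.1 (arXiv v5 p. 17: the interval condition and "such a moment necessarily occurs")] -/
theorem exists_isFirstTouch (g : ℤ) (h : ∃ t ∈ P, ∃ w ∈ Q, w 1 ≤ t 1 + 1 ∧ t 1 ≤ w 1 + 1) (p : ℤ) :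
    ∃ s, s % 2 = p % 2 ∧ IsFirstTouch g P Q s := by
  classical
  obtain ⟨t, ht, w, hw, hy1, hy2⟩ := h
  set S := (touchShifts g P Q).filter fun s => s % 2 = p % 2 with hS
  have hne : S.Nonempty := by
    rcases Int.emod_two_eq_zero_or_one (t 0 + g - w 0 - p) with he | ho
    · refine ⟨t 0 + g - w 0, Finset.mem_filter.2 ⟨mem_touchShifts_iff.2 ⟨t, ht, w, hw, ?_⟩, by omega⟩⟩
      unfold IsNearShift; omega
    · refine ⟨t 0 + g + 1 - w 0, Finset.mem_filter.2 ⟨mem_touchShifts_iff.2 ⟨t, ht, w, hw, ?_⟩, by omega⟩⟩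
      unfold IsNearShift; omega
  have hmax := Finset.mem_filter.1 (hS.le (Finset.max'_mem S hne))
  refine ⟨S.max' hne, hmax.2, mem_touchShifts_iff.1 hmax.1, fun k hk hcon => ?_⟩
  have hmem : S.max' hne + 2 * k ∈ S :=
    hS.ge (Finset.mem_filter.2 ⟨mem_touchShifts_iff.2 hcon, by omega⟩)
  have hle := Finset.le_max' S _ hmem
  omega

end HexBW

end Literature.Probability.RandomPlanarGeometry.SAW

end
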